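import Summits.AnomalousDissipation.AnomalousDissipation.Theses.TwoAndHalfD
import Summits.AnomalousDissipation.AnomalousDissipation.Theorems.TwoAndHalfDScalarAnomalySteadySourceFormalColdStartVariance
import Literature.Analysis.FluidPDE.TwoHalfNavierStokes
import Literature.Analysis.FluidPDE.TwoHalfWeakEuler
import Literature.Analysis.FluidPDE.TorusClassicalLerayHopfProofs

/-!
# Line `duhamel-release` (slug `Sketch`) of the crux `TwoAndHalfD.TwohalfdThesis` (stmt-AnomalousDissipation-0206):
# the classical 2½-D lift and the kernel-checked composition

Support file (everything proved; `--supports stmt-AnomalousDissipation-0206`) for the lead's registered skeleton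
`Cruxes/TwohalfdThesis/Lines/Sketch.lean` (namespace `…Cruxes.TwohalfdThesis.DuhamelRelease`, not importable).  It holds
the two sorry-free pieces of the line, stated in tree vocabulary only (no definitions):

* `lift_isClassicalNSSolutionOn` (T1) — if `(v, p)` solves the planar Navier–Stokes system forced by a steady `g` on
  `[0, ∞) × T²` classically and `θ` solves `∂ₜθ + v·∇θ = νΔθ + h` classically (Prandtl number one), then
  `((v, θ)∘π, p∘π)` is a classical solution of the 3-D system on `[0, ∞) × T³` forced by the steady 2½-D field `(g, h)∘π`
  (Majda–Bertozzi 2002 §2.3.1 Prop. 2.7; Bruè–De Lellis 2023 §3; in tree `Torus.isClassicalNSSolutionOn_twoHalf`, whose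
  residual force is identified with `(g, h)∘π` through the two equations);
* `TwohalfdThesis_of` — the composition of the line: the five registered stub STATEMENTS (W released-family mixing
  witness, D0 weak Duhamel, D1 Duhamel variance bound, D2 dissipation floor, T2 lift budgets), taken as hypotheses,
  imply `TwohalfdThesis` BY NAME.  The cold starts come from the landed
  `ScalarAnomalySteadySourceFormal.ColdStartVariance.exists_global_coldStart`; classical 2½-D solutions are global
  Leray–Hopf solutions by `IsClassicalNSSolutionOn.isLerayHopfOn_of_convex`; `x₃`-invariance is `Torus.twoHalf_add_single`.

As the stubs land (`Theorems/TwoAndHalfDTwohalfdThesisStub*.lean`, `--supports`), `TwohalfdThesis_of` consumes them;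
the crux then rests on W alone (the open residual; see the skeleton's docstring and `Cruxes/TwohalfdThesis/PICKED.md`).
-/

noncomputable section

-- D-0017: single-problem summit ⇒ `Summit.AnomalousDissipation.AnomalousDissipation.…`.
set_option linter.dupNamespace false

namespace Summit.AnomalousDissipation.AnomalousDissipation.Theorems.TwohalfdThesis

open MeasureTheory Set Filter Topology
open scoped ENNReal NNReal InnerProductSpace
open Literature.Analysis.FunctionSpaces Literature.Analysis.FluidPDE
open Summit.AnomalousDissipation.AnomalousDissipation.Theses.TwoAndHalfD

/-! ## T1 — the classical 2½-D lift -/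

/-- **T1 (proved).** If `(v, p)` is a classical solution of the planar Navier–Stokes system forced by the steady `g` on
`[0, ∞) × T²` and `θ` a classical solution of `∂ₜθ + v·∇θ = νΔθ + h` (same `ν`: Prandtl number one) on `[0, ∞)`, then
`u(t) := (v(t), θ(t))∘π`, `P(t) := p(t)∘π` is a classical solution of the 3-D Navier–Stokes system on `[0, ∞) × T³`
forced by the steady 2½-D field `(g, h)∘π` (`Torus.isClassicalNSSolutionOn_twoHalf`, whose residual force
`twoHalfForce` is identified with `(g,h)∘π` through the two equations). [folklore] -/
theorem lift_isClassicalNSSolutionOn :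
    ∀ (ν : ℝ) (g : UnitAddTorus (Fin 2) → EuclideanSpace ℝ (Fin 2)) (h : UnitAddTorus (Fin 2) → ℝ)
      (v : ℝ → UnitAddTorus (Fin 2) → EuclideanSpace ℝ (Fin 2)) (p : ℝ → UnitAddTorus (Fin 2) → ℝ)
      (θ : ℝ → UnitAddTorus (Fin 2) → ℝ),
      Torus.IsClassicalNSSolutionOn (Ici 0) ν (fun _ => g) v p →
      Torus.IsClassicalScalarTransportForcedOn (Ici 0) ν v (fun _ => h) θ →
      Torus.IsClassicalNSSolutionOn (Ici 0) ν (fun _ => Torus.twoHalf g h)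
        (fun t => Torus.twoHalf (v t) (θ t)) (fun t => p t ∘ Torus.planarProj) := by
  intro ν g h v p θ hv hθ
  have H := Torus.isClassicalNSSolutionOn_twoHalf (uniqueDiffOn_Ici 0) ν hv.smooth_velocity hθ.smooth_scalar
    hv.smooth_pressure hv.divFree
  refine ⟨H.smooth_velocity, H.smooth_pressure, fun t ht x => ?_, H.divFree⟩
  rw [H.momentum t ht x]
  congr 1
  show Torus.twoHalf _ _ x = Torus.twoHalf g h x
  congr 1
  · funext y
    have e := hv.momentum t ht y
    rw [e]
    abel
  · funext y
    have e := hθ.transport t ht y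
    linarith

/-! ## Composition — the crux BY NAME from the five registered stub statements -/

/-- **`TwohalfdThesis_of`** (the line's composition, kernel-checked).  Hypotheses, verbatim the registered stubs of
`Cruxes/TwohalfdThesis/Lines/Sketch.lean`: `hW` = W `stub_releasedMixingWitness` (C⁺: a steadily forced classical 2-D
Navier–Stokes family with pointwise energy bound `E`, the classical released families `φ_j s` of the pattern `h`, one
integrable envelope `Λ` (`∫₀^∞ Λ ≤ M`) valid for release times `s ≥ s₀` uniformly in `j`, and a Green–Kubo floor `ε`);
`hD0` = D0 `stub_weakDuhamel` (weak Duhamel identity `∫ θ(t)χ = ∫₀ᵗ (∫ φ_s(t) χ) ds` for the classical cold start `θ`);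
`hD1` = D1 `stub_duhamelVariance` (`‖θ(t)‖² ≤ (s₀+M)²‖h‖²`); `hD2` = D2 `stub_dissipationFloor` (liminf-mean input power
`≥ ε` + bounded variance ⇒ `⟨κ‖∇θ‖²⟩ ≥ ε`); `hT2` = T2 `stub_liftBudget` (`meanEnergy ((v,θ)∘π) ≤ E + B`,
`⟨ν‖∇θ‖²⟩ ≤ meanDissipation ν ((v,θ)∘π)`).  PROOF: W gives `(g, h)`, the NS family, the released families, envelope
and floor; `exists_global_coldStart` gives the classical cold starts `θ_j`; D0 the identity; D1 the variance bound; the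
GK floor rewritten through D0 (`χ = h`, under `timeMean`/`liminf` for `T ≥ 0`) is a liminf-mean input-power floor, so
D2 gives `⟨ν_j‖∇θ_j‖²⟩ ≥ ε`; T1 makes `u_j = (v_j, θ_j)∘π` classical, forced by `f = (g,h)∘π`, hence global
Leray–Hopf from its initial slice; `f` and every `u_j t` are `x₃`-invariant (`twoHalf_add_single`), `f` is smooth,
solenoidal and mean zero; T2 gives `meanEnergy ≤ E + (s₀+M)²‖h‖²` and `meanDissipation ≥ ε`. -/
theorem TwohalfdThesis_of
    (hW : ∃ (g : (UnitAddTorus (Fin 2)) → (EuclideanSpace ℝ (Fin 2))) (h : (UnitAddTorus (Fin 2)) → ℝ),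
      Torus.IsSmooth g ∧ Torus.IsDivFree g ∧ Torus.HasZeroMean g ∧ Torus.IsSmooth h ∧ Torus.HasZeroMean h ∧
      ∃ (ν : ℕ → ℝ) (v : ℕ → ℝ → (UnitAddTorus (Fin 2)) → (EuclideanSpace ℝ (Fin 2))) (p : ℕ → ℝ → (UnitAddTorus (Fin 2)) → ℝ) (φ : ℕ → ℝ → ℝ → (UnitAddTorus (Fin 2)) → ℝ)
        (Λ : ℝ → ℝ) (E s₀ M ε : ℝ),
        (∀ j, 0 < ν j) ∧ Tendsto ν atTop (𝓝 0) ∧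
        (∀ j, Torus.IsClassicalNSSolutionOn (Ici 0) (ν j) (fun _ => g) (v j) (p j)) ∧
        (∀ j t, 0 ≤ t → ∫ x, ‖v j t x‖ ^ 2 ≤ E) ∧
        (∀ j s, 0 ≤ s → Torus.IsClassicalScalarTransportOn (Ici s) (ν j) (v j) (φ j s) ∧ φ j s s = h) ∧
        0 ≤ s₀ ∧ (∀ τ, 0 ≤ Λ τ) ∧ IntegrableOn Λ (Ici 0) ∧ (∫ τ in Ici 0, Λ τ) ≤ M ∧
        (∀ j s t, s₀ ≤ s → s ≤ t → Torus.scalarL2Sq (φ j s t) ≤ Λ (t - s) ^ 2 * Torus.scalarL2Sq h) ∧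
        0 < ε ∧
        (∀ j, ε ≤ liminf (timeMean fun t => ∫ s in (0 : ℝ)..t, ∫ x, h x * φ j s t x) atTop))
    (hD0 : ∀ (κ : ℝ) (u : ℝ → (UnitAddTorus (Fin 2)) → (EuclideanSpace ℝ (Fin 2))) (h : (UnitAddTorus (Fin 2)) → ℝ) (θ : ℝ → (UnitAddTorus (Fin 2)) → ℝ) (φ : ℝ → ℝ → (UnitAddTorus (Fin 2)) → ℝ),
      0 < κ → Torus.IsSmooth h →
      Torus.IsClassicalScalarTransportForcedOn (Ici 0) κ u (fun _ => h) θ → θ 0 = (fun _ => (0 : ℝ)) →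
      (∀ s, 0 ≤ s → Torus.IsClassicalScalarTransportOn (Ici s) κ u (φ s) ∧ φ s s = h) →
      ∀ χ : (UnitAddTorus (Fin 2)) → ℝ, Torus.IsSmooth χ → ∀ t, 0 ≤ t →
        ∫ x, θ t x * χ x = ∫ s in (0 : ℝ)..t, ∫ x, φ s t x * χ x)
    (hD1 : ∀ (κ s₀ M : ℝ) (u : ℝ → (UnitAddTorus (Fin 2)) → (EuclideanSpace ℝ (Fin 2))) (h : (UnitAddTorus (Fin 2)) → ℝ) (θ : ℝ → (UnitAddTorus (Fin 2)) → ℝ) (φ : ℝ → ℝ → (UnitAddTorus (Fin 2)) → ℝ)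
        (Λ : ℝ → ℝ),
      0 ≤ κ → Torus.IsSmooth h →
      Torus.IsClassicalScalarTransportForcedOn (Ici 0) κ u (fun _ => h) θ →
      (∀ s, 0 ≤ s → Torus.IsClassicalScalarTransportOn (Ici s) κ u (φ s) ∧ φ s s = h) →
      (∀ χ : (UnitAddTorus (Fin 2)) → ℝ, Torus.IsSmooth χ → ∀ t, 0 ≤ t →
          ∫ x, θ t x * χ x = ∫ s in (0 : ℝ)..t, ∫ x, φ s t x * χ x) →
      0 ≤ s₀ → (∀ τ, 0 ≤ Λ τ) → IntegrableOn Λ (Ici 0) → (∫ τ in Ici 0, Λ τ) ≤ M →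
      (∀ s t, s₀ ≤ s → s ≤ t → Torus.scalarL2Sq (φ s t) ≤ Λ (t - s) ^ 2 * Torus.scalarL2Sq h) →
      ∀ t, 0 ≤ t → Torus.scalarL2Sq (θ t) ≤ (s₀ + M) ^ 2 * Torus.scalarL2Sq h)
    (hD2 : ∀ (κ B ε : ℝ) (u : ℝ → (UnitAddTorus (Fin 2)) → (EuclideanSpace ℝ (Fin 2))) (h : (UnitAddTorus (Fin 2)) → ℝ) (θ : ℝ → (UnitAddTorus (Fin 2)) → ℝ),
      0 ≤ κ → Torus.IsSmooth h →
      Torus.IsClassicalScalarTransportForcedOn (Ici 0) κ u (fun _ => h) θ →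
      (∀ t, 0 ≤ t → Torus.scalarL2Sq (θ t) ≤ B) →
      ε ≤ liminf (timeMean fun t => ∫ x, h x * θ t x) atTop →
      ε ≤ longTimeAvgSup (fun t => κ * (Torus.eScalarGradNormSq (θ t)).toReal))
    (hT2 : ∀ (ν E B : ℝ) (g : (UnitAddTorus (Fin 2)) → (EuclideanSpace ℝ (Fin 2))) (h : (UnitAddTorus (Fin 2)) → ℝ) (v : ℝ → (UnitAddTorus (Fin 2)) → (EuclideanSpace ℝ (Fin 2))) (p : ℝ → (UnitAddTorus (Fin 2)) → ℝ) (θ : ℝ → (UnitAddTorus (Fin 2)) → ℝ),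
      0 < ν → Torus.IsSmooth g → Torus.IsSmooth h →
      Torus.IsClassicalNSSolutionOn (Ici 0) ν (fun _ => g) v p →
      Torus.IsClassicalScalarTransportForcedOn (Ici 0) ν v (fun _ => h) θ →
      (∀ t, 0 ≤ t → ∫ x, ‖v t x‖ ^ 2 ≤ E) → (∀ t, 0 ≤ t → Torus.scalarL2Sq (θ t) ≤ B) →
      meanEnergy (fun t => Torus.twoHalf (v t) (θ t)) ≤ E + B ∧
        longTimeAvgSup (fun t => ν * (Torus.eScalarGradNormSq (θ t)).toReal) ≤
          meanDissipation ν (fun t => Torus.twoHalf (v t) (θ t))) :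
    TwohalfdThesis := by
  obtain ⟨g, h, hgs, hgd, hgm, hhs, hhm, ν, v, p, φ, Λ, E, s₀, M, ε, hν, hν0, hNS, hE, hφ, hs₀, hΛ0, hΛi, hΛM,
    hEnv, hε, hGK⟩ := hW
  -- the classical cold starts `θ_j` (landed: gluing of the tree's unique classical solutions on `[0, N+1]`)
  have hex : ∀ j, ∃ θ : ℝ → (UnitAddTorus (Fin 2)) → ℝ,
      Torus.IsClassicalScalarTransportForcedOn (Ici 0) (ν j) (v j) (fun _ => h) θ ∧ θ 0 = fun _ => 0 := fun j =>
    Summit.AnomalousDissipation.AnomalousDissipation.Theorems.ScalarAnomalySteadySourceFormal.ColdStartVariance.exists_global_coldStart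
      (hν j) (hNS j).smooth_velocity (hNS j).divFree hhs
  choose θ hθ hθ0 using hex
  -- D0: weak Duhamel
  have hId : ∀ j (χ : (UnitAddTorus (Fin 2)) → ℝ), Torus.IsSmooth χ → ∀ t, 0 ≤ t →
      ∫ x, θ j t x * χ x = ∫ s in (0 : ℝ)..t, ∫ x, φ j s t x * χ x := fun j =>
    hD0 (ν j) (v j) h (θ j) (φ j) (hν j) hhs (hθ j) (hθ0 j) (hφ j)
  -- D1: the variance bound
  have hVar : ∀ j t, 0 ≤ t → Torus.scalarL2Sq (θ j t) ≤ (s₀ + M) ^ 2 * Torus.scalarL2Sq h := fun j =>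
    hD1 (ν j) s₀ M (v j) h (θ j) (φ j) Λ (hν j).le hhs (hθ j) (hφ j) (hId j) hs₀ hΛ0 hΛi hΛM
      (hEnv j)
  -- the Green–Kubo floor is an input-power floor (D0 with `χ = h`)
  have hPow : ∀ j, ε ≤ liminf (timeMean fun t => ∫ x, h x * θ j t x) atTop := by
    intro j
    have heq : (timeMean fun t => ∫ s in (0 : ℝ)..t, ∫ x, h x * φ j s t x) =ᶠ[atTop]
        (timeMean fun t => ∫ x, h x * θ j t x) := by
      filter_upwards [eventually_ge_atTop (0 : ℝ)] with T hT
      unfold timeMean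
      congr 1
      refine intervalIntegral.integral_congr fun t ht => ?_
      rw [uIcc_of_le hT] at ht
      have e := hId j h hhs t ht.1
      simp_rw [mul_comm (h _)]
      exact e.symm
    rw [← Filter.liminf_congr heq]
    exact hGK j
  -- D2: the dissipation floor
  have hDiss : ∀ j, ε ≤ longTimeAvgSup (fun t => ν j * (Torus.eScalarGradNormSq (θ j t)).toReal) := fun j =>
    hD2 (ν j) ((s₀ + M) ^ 2 * Torus.scalarL2Sq h) ε (v j) h (θ j) (hν j).le hhs (hθ j) (hVar j)
      (hPow j)
  -- T1: the classical lift, hence global Leray–Hopf from its own initial slice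
  have hcl : ∀ j, Torus.IsClassicalNSSolutionOn (Ici 0) (ν j) (fun _ => Torus.twoHalf g h)
      (fun t => Torus.twoHalf (v j t) (θ j t)) (fun t => p j t ∘ Torus.planarProj) := fun j =>
    lift_isClassicalNSSolutionOn _ _ _ _ _ _ (hNS j) (hθ j)
  -- T2: budgets
  have hB := fun j => hT2 (ν j) E ((s₀ + M) ^ 2 * Torus.scalarL2Sq h) g h (v j) (p j) (θ j) (hν j)
    hgs hhs (hNS j) (hθ j) (hE j) (hVar j)
  refine ⟨Torus.twoHalf g h, ?_, hgs.twoHalf hhs, hgd.twoHalf h,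
    Torus.hasZeroMean_twoHalf hgs.integrable hhs.integrable hgm hhm, ν,
    fun j => Torus.twoHalf (v j 0) (θ j 0), fun j t => Torus.twoHalf (v j t) (θ j t), hν, hν0, ?_, ?_,
    ⟨E + (s₀ + M) ^ 2 * Torus.scalarL2Sq h, fun j => (hB j).1⟩, ε, hε, fun j => (hDiss j).trans (hB j).2⟩
  · intro s x
    rw [← Torus.last_two_eq]
    exact Torus.twoHalf_add_single g h s x
  · intro j T hT
    exact (hcl j).isLerayHopfOn_of_convex (convex_Ici 0) hT Icc_subset_Ici_self
  · intro j t s x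
    rw [← Torus.last_two_eq]
    exact Torus.twoHalf_add_single _ _ s x

end Summit.AnomalousDissipation.AnomalousDissipation.Theorems.TwohalfdThesis

end
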